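import Summits.BirchSwinnertonDyer.BirchSwinnertonDyer.Theorems.Rank2ObservatoryCertificate
import Literature.NumberTheory.EllipticCurves.HeegnerHypothesisKroneckerProofs
import Literature.Barriers.BirchSwinnertonDyer.RankNotSumOfLocalInvariantsC3C3Proofs
import Literature.NumberTheory.EllipticCurves.AnalyticRankOverNumberFieldProofs
import HarnessLib

/-!
# BirchSwinnertonDyer — rank ≥ 2 observatory: exact vanishing of `L'(E,1)` (rank-3 certificates)

HONEST FRAMING: per-curve certified theorems and census instruments; no claim on BSD in rank ≥ 2.

The rank-3 certificate of the observatory (`certs/rank3/<label>.json`, schema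
`bsdr2-rank3-twoengine/v1`) records `L'(E,1) = 0` EXACTLY, not as an interval: by REFEREE ruling
R1/R1.L this is the Gross–Zagier–Kolyvagin theorem over an explicit imaginary quadratic field
`K = ℚ(√D)` satisfying the Heegner hypothesis for `N_E`, in contrapositive. This file is the
kernel-checked form of that step, for an arbitrary `W/ℚ`, with every analytic input a NAMED
hypothesis taken from the tree's Literature (nothing minted here):

* `hE : WeierstrassCurve.hasEntireLFunction_rat` — modularity ⇒ `L(E,s)` and `L(E^{d_K},s)` are
  entire (certificate hypothesis `MODULARITY`);
* `hGZK : mordellWeilRank_eq_one_of_LDerivEK_ne_zero W K` — Gross–Zagier 1986 I.(6.3) +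
  Kolyvagin 1990 Thm. A (Gross 1991 (1.1) + Thm. 1.3; Cai–Shu–Tian 2014 Thm. 1.1 for even `d_K`),
  the tree's named fact (`HeegnerPoints.lean`): `L'(E/K,1) ≠ 0 ⇒ rank E(K) = 1`
  (certificate hypothesis `GZ_KOLYVAGIN_K` / `GZ_KOLYVAGIN_EXPLICIT_D`);
* `hK`, `hH` — `K` imaginary quadratic and the Heegner hypothesis for `(N_E, K)`; per curve the
  latter is DECIDED from `d_K` by the Kronecker criterion `satisfiesHeegnerHypothesis_iff_kronecker`
  (certificate field `heegner.chosen`, hypothesis `HEEGNER_KRONECKER`);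
* `h2 : 2 ≤ rank_ℤ E(ℚ)` — from the certified independent points (the certificate has `3 ≤`; only
  `rank E(K) ≠ 1` is used, via the PROVED monotonicity `rank E(ℚ) ≤ rank E(K)`);
* `hL1 : L(E,1) = 0` (root number `−1`, exact) and `hLD : L(E^{d_K},1) ≠ 0` (certified ball for the
  twist, two engines: PARI `lfun`/modular symbol in engine P, integer-interval `Λ`-series in engine B).

Conclusion: `deriv L(E,s)|_{s=1} = 0`. Proof: `rank E(K) ≥ rank E(ℚ) ≥ 2`, so `rank E(K) ≠ 1`, so
`L'(E/K,1) = 0` by `hGZK`; `L(E/K,s) = L(E,s)·L(E^{d_K},s)` and the product rule with `L(E,1) = 0`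
give `L'(E,1)·L(E^{d_K},1) = 0`, and `L(E^{d_K},1) ≠ 0`. (Gross 1991 (1.1); the same computation as
the tree's barrier `Literature.Barriers.BirchSwinnertonDyer.HeegnerPointsRankOne`, read in the other
direction.) The per-curve files `Rank2Observatory<Label>.lean` (rank 3) instantiate
`deriv_entireLFunction_one_eq_zero_of_heegnerField` with the certificate's `D`.

References: B. H. Gross, *Kolyvagin's work on modular elliptic curves*, LMS LNS 153 (1991), (1.1)
and Thm. 1.3; B. H. Gross, D. Zagier, Invent. Math. 84 (1986), Thm. I.(6.3); V. A. Kolyvagin,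
Progr. Math. 87 (1990), Thm. A; L. Cai, J. Shu, Y. Tian, Algebra Number Theory 8 (2014), Thm. 1.1;
H. Darmon, CBMS 101 (2004), Hypothesis 3.9 and Thm. 3.22.
-/

-- single-conjunct summit: `Summit.BirchSwinnertonDyer.BirchSwinnertonDyer.…` repeats the name by design
set_option linter.dupNamespace false

noncomputable section

open scoped Classical

namespace Summit.BirchSwinnertonDyer.BirchSwinnertonDyer.Rank2Observatory

open Literature Literature.NumberTheory.EllipticCurves WeierstrassCurve

variable (W : WeierstrassCurve ℚ) [W.IsElliptic] (K : Type) [Field K] [NumberField K]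

/-- **The rank does not drop under base change**: `rank_ℤ E(ℚ) ≤ rank_ℤ E(K)` for a number field
`K` (`E(ℚ) ↪ E(K)` and `E(K)` is finitely generated — the tree's
`mordellWeilRank_baseChange_le_of_algHom` with `ℚ → K`, and `W.baseChange ℚ = W`,
`WeierstrassCurve.baseChange_rat`). [folklore] -/
theorem mordellWeilRank_le_mordellWeilRank_baseChange :
    W.mordellWeilRank ≤ (W.baseChange K).mordellWeilRank := by
  have h := Literature.Barriers.BirchSwinnertonDyer.DokchitserDokchitser2011.mordellWeilRank_baseChange_le_of_algHom
    W (F := K) (K := ℚ) (Algebra.ofId ℚ K)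
  rwa [WeierstrassCurve.baseChange_rat] at h

/-- **`L'(E,1) = 0` exactly, from Gross–Zagier–Kolyvagin over a Heegner field** (REFEREE R1.L;
Gross 1991 (1.1) + Thm. 1.3 in contrapositive). For `W/ℚ` globally minimal and elliptic, `K`
imaginary quadratic with the Heegner hypothesis for `N_E`: if `rank_ℤ E(ℚ) ≥ 2`, `L(E,1) = 0` and
`L(E^{d_K},1) ≠ 0`, then `deriv L(E,·) 1 = 0`. Inputs `hE` (modularity: entire continuation) and
`hGZK` (Gross–Zagier + Kolyvagin over `K`) are the tree's NAMED FACTS, taken as hypotheses.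
[cite: GrossLMS1991, (1.1) and Thm. 1.3] [cite: Darmon2004, Thm. 3.22] -/
theorem deriv_entireLFunction_one_eq_zero_of_heegnerField [W.IsGloballyMinimal]
    [NeZero (W.conductorNorm ℤ)]
    (hE : WeierstrassCurve.hasEntireLFunction_rat)
    (hGZK : mordellWeilRank_eq_one_of_LDerivEK_ne_zero W K)
    (hK : IsImaginaryQuadratic K) (hH : SatisfiesHeegnerHypothesis (W.conductorNorm ℤ) K)
    (h2 : 2 ≤ W.mordellWeilRank) (hL1 : W.entireLFunction 1 = 0)
    (hLD : (W.quadraticTwist (NumberField.discr K : ℚ)).entireLFunction 1 ≠ 0) :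
    deriv W.entireLFunction 1 = 0 := by
  -- rank E(K) ≥ rank E(ℚ) ≥ 2, so rank E(K) ≠ 1 and Gross–Zagier–Kolyvagin forces L'(E/K,1) = 0
  have hKr : (W.baseChange K).mordellWeilRank ≠ 1 := by
    have := mordellWeilRank_le_mordellWeilRank_baseChange W K
    omega
  have hLK : LDerivEK W K = 0 := by
    by_contra h
    exact hKr (hGZK hK hH h).1
  -- product rule: L'(E/K,1) = L'(E,1) L(E^D,1) + L(E,1) L'(E^D,1) = L'(E,1) L(E^D,1)
  have hd : (NumberField.discr K : ℚ) ≠ 0 := by exact_mod_cast NumberField.discr_ne_zero K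
  haveI := W.isElliptic_quadraticTwist hd
  have hdW : DifferentiableAt ℂ W.entireLFunction 1 := (W.differentiable_entireLFunction (hE W)) 1
  have hdT : DifferentiableAt ℂ (W.quadraticTwist (NumberField.discr K : ℚ)).entireLFunction 1 :=
    ((W.quadraticTwist _).differentiable_entireLFunction (hE _)) 1
  unfold LDerivEK at hLK
  rw [deriv_fun_mul hdW hdT, hL1, zero_mul, add_zero] at hLK
  exact (mul_eq_zero.mp hLK).resolve_right hLD

/-- Same, with the level supplied as a number: if `N_E = N` (certificate field `conductor`, Tate's
algorithm in both engines) and every prime `p ∣ N` satisfies the Kronecker condition for `d_K`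
(`p = 2 → d_K ≡ 1 (mod 8)`, `p` odd → `(d_K/p) = 1`; decided per curve by `norm_num`), the Heegner
hypothesis holds (`satisfiesHeegnerHypothesis_iff_kronecker`) and the previous theorem applies.
[cite: GrossLMS1991, (1.1) and Thm. 1.3] [cite: Darmon2004, Hypothesis 3.9] -/
theorem deriv_entireLFunction_one_eq_zero_of_kronecker [W.IsGloballyMinimal] {N : ℕ} (hN0 : N ≠ 0)
    (hN : W.conductorNorm ℤ = N)
    (hE : WeierstrassCurve.hasEntireLFunction_rat)
    (hGZK : mordellWeilRank_eq_one_of_LDerivEK_ne_zero W K)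
    (hK : IsImaginaryQuadratic K)
    (hkr : ∀ p : ℕ, p.Prime → p ∣ N →
      (p = 2 → NumberField.discr K % 8 = 1) ∧ (p ≠ 2 → jacobiSym (NumberField.discr K) p = 1))
    (h2 : 2 ≤ W.mordellWeilRank) (hL1 : W.entireLFunction 1 = 0)
    (hLD : (W.quadraticTwist (NumberField.discr K : ℚ)).entireLFunction 1 ≠ 0) :
    deriv W.entireLFunction 1 = 0 := by
  haveI : NeZero (W.conductorNorm ℤ) := ⟨by rw [hN]; exact hN0⟩
  have hH : SatisfiesHeegnerHypothesis (W.conductorNorm ℤ) K := by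
    rw [hN]
    exact (satisfiesHeegnerHypothesis_iff_kronecker N K hK.1).mpr hkr
  exact deriv_entireLFunction_one_eq_zero_of_heegnerField W K hE hGZK hK hH h2 hL1 hLD

end Summit.BirchSwinnertonDyer.BirchSwinnertonDyer.Rank2Observatory

end
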